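import Literature.Analysis.Complex.SmoothHypersurfaceDivision
import Literature.Analysis.Complex.OsgoodProofs
import HarnessLib

/-!
# Division of even holomorphic functions by `u²` (Hadamard's lemma in a symmetric variable)

Local complex analysis in several variables (E. M. Chirka, *Complex Analytic Sets* (1989), §2.8: division by a
coordinate function; the even case is the same lemma applied twice).  Written by the prover seat
`hodge-nonav-prover-Bx` (g12, cell `hodge-nonav`) for the bifurcation analysis of the symmetric `A₃` point
(`Literature/AlgebraicGeometry/HodgeTheory/SymmetricA3*`, programme B2-BIF), where the reduced function `r(μ, u)` is
even in the kernel coordinate `u`.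

On a product domain `V × {|u| < R}` (so that the reflection `u ↦ −u` and the axis `u = 0` stay inside):

* `SCV.exists_sq_mul_of_even` — a holomorphic `f(z, u)`, even in `u` and vanishing on `u = 0`, is `u² · q(z, u)` with
  `q` holomorphic and even (divide by `u`; the quotient is odd, hence vanishes on `u = 0`; divide again);
* `SCV.eq_two_mul_add_of_sq_mul` — if `f = u² q` and `∂_u f = u · s` with `s` continuous, then `s = 2 q + u ∂_u q`
  (on `u ≠ 0` by the product rule, on `u = 0` by continuity);
* `SCV.fderiv_eq_smul_of_eq_mul` — if `f = t · g` and `t(p₀) = 0` then `df(p₀) = g(p₀) dt(p₀)`.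

## References
* [Chirka1989] E. M. Chirka, *Complex Analytic Sets*, Kluwer 1989, §2.8.
-/

noncomputable section

open Metric Set Filter
open scoped Topology

namespace Literature.Analysis.Complex
namespace SCV

variable {E : Type*} [NormedAddCommGroup E] [NormedSpace ℂ E]

/-- A continuous function on a punctured neighbourhood of `0 ∈ ℂ` which vanishes off `0` vanishes at `0`. [folklore] -/
private theorem eq_zero_of_eventually_ne {g : ℂ → ℂ} (hg : ContinuousAt g 0) (h : ∀ᶠ u in 𝓝[≠] (0 : ℂ), g u = 0) :
    g 0 = 0 := by
  have h1 : Tendsto g (𝓝[≠] (0 : ℂ)) (𝓝 (g 0)) := hg.tendsto.mono_left nhdsWithin_le_nhds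
  have h2 : Tendsto g (𝓝[≠] (0 : ℂ)) (𝓝 0) :=
    (tendsto_congr' h).2 tendsto_const_nhds
  exact tendsto_nhds_unique h1 h2

/-- **Even holomorphic functions vanishing on `u = 0` are divisible by `u²`.**  Let `V ⊆ E` be open and
`f : E × ℂ → ℂ` holomorphic on `V × {|u| < R}`, even in `u` and zero on `u = 0`.  Then `f(z, u) = u² · q(z, u)` with
`q` holomorphic on `V × {|u| < R}` and even in `u`. [cite: Chirka1989, §2.8] -/
theorem exists_sq_mul_of_even {V : Set E} (hV : IsOpen V) {R : ℝ} {f : E × ℂ → ℂ}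
    (hf : DifferentiableOn ℂ f (V ×ˢ ball (0 : ℂ) R))
    (heven : ∀ p ∈ V ×ˢ ball (0 : ℂ) R, f (p.1, -p.2) = f p)
    (h0 : ∀ p ∈ V ×ˢ ball (0 : ℂ) R, p.2 = 0 → f p = 0) :
    ∃ q : E × ℂ → ℂ, DifferentiableOn ℂ q (V ×ˢ ball (0 : ℂ) R) ∧
      (∀ p ∈ V ×ˢ ball (0 : ℂ) R, f p = p.2 ^ 2 * q p) ∧
      (∀ p ∈ V ×ˢ ball (0 : ℂ) R, q (p.1, -p.2) = q p) := by
  have hU : IsOpen (V ×ˢ ball (0 : ℂ) R) := hV.prod isOpen_ball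
  have hrefl : ∀ p ∈ V ×ˢ ball (0 : ℂ) R, (p.1, -p.2) ∈ V ×ˢ ball (0 : ℂ) R := fun p hp =>
    ⟨hp.1, by simpa using hp.2⟩
  -- the coordinate `u`
  have htd : DifferentiableOn ℂ (fun p : E × ℂ => p.2) (V ×ˢ ball (0 : ℂ) R) := differentiableOn_snd
  have hdt : ∀ p ∈ V ×ˢ ball (0 : ℂ) R, (fun p : E × ℂ => p.2) p = 0 → fderiv ℂ (fun p : E × ℂ => p.2) p ≠ 0 := by
    intro p _ _ hzero
    have h1 : fderiv ℂ (fun p : E × ℂ => p.2) p = ContinuousLinearMap.snd ℂ E ℂ :=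
      (ContinuousLinearMap.snd ℂ E ℂ).hasFDerivAt.fderiv
    have := congr_arg (fun L : E × ℂ →L[ℂ] ℂ => L (0, 1)) (h1.symm.trans hzero)
    simp at this
  -- first division: `f = u q₁`
  obtain ⟨q₁, hq₁d, hq₁⟩ := exists_eq_smul_of_eqOn_zero hU htd hf hdt h0
  simp only [smul_eq_mul] at hq₁
  -- `q₁` is odd, hence vanishes on `u = 0`
  have hodd : ∀ p ∈ V ×ˢ ball (0 : ℂ) R, p.2 ≠ 0 → q₁ (p.1, -p.2) = -q₁ p := by
    intro p hp hne
    have h1 := hq₁ p hp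
    have h2 := hq₁ _ (hrefl p hp)
    rw [heven p hp, h1] at h2
    -- h2 : p.2 * q₁ p = -p.2 * q₁ (p.1, -p.2)
    have h3 : p.2 * (q₁ (p.1, -p.2) + q₁ p) = 0 := by
      have : ((p.1, -p.2) : E × ℂ).2 = -p.2 := rfl
      rw [this] at h2
      linear_combination h2
    exact eq_neg_of_add_eq_zero_left ((mul_eq_zero.1 h3).resolve_left hne)
  have hq₁0 : ∀ p ∈ V ×ˢ ball (0 : ℂ) R, (fun p : E × ℂ => p.2) p = 0 → q₁ p = 0 := by
    intro p hp hp0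
    change p.2 = 0 at hp0
    -- the continuous function `u ↦ q₁(z, u) + q₁(z, -u)` vanishes for `u ≠ 0` near `0`, hence at `0`
    have hz : p = (p.1, 0) := Prod.ext rfl hp0
    have hcont : ContinuousAt (fun u : ℂ => q₁ (p.1, u) + q₁ (p.1, -u)) 0 := by
      have hc : ContinuousOn q₁ (V ×ˢ ball (0 : ℂ) R) := hq₁d.continuousOn
      have h1 : ContinuousAt q₁ (p.1, 0) := hc.continuousAt (hU.mem_nhds (hz ▸ hp))
      have e1 : ContinuousAt (fun u : ℂ => ((p.1, u) : E × ℂ)) 0 := by fun_prop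
      have e2 : ContinuousAt (fun u : ℂ => ((p.1, -u) : E × ℂ)) 0 := by fun_prop
      exact (h1.comp_of_eq e1 rfl).add (h1.comp_of_eq e2 (by simp))
    have hball : ∀ᶠ u in 𝓝 (0 : ℂ), ((p.1, u) : E × ℂ) ∈ V ×ˢ ball (0 : ℂ) R := by
      have e1 : Continuous (fun u : ℂ => ((p.1, u) : E × ℂ)) := by fun_prop
      exact e1.continuousAt.preimage_mem_nhds (hU.mem_nhds (by exact hz ▸ hp))
    have hev : ∀ᶠ u in 𝓝[≠] (0 : ℂ), q₁ (p.1, u) + q₁ (p.1, -u) = 0 := by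
      have h' : ∀ᶠ u in 𝓝[≠] (0 : ℂ), u ≠ 0 := self_mem_nhdsWithin
      filter_upwards [h', mem_nhdsWithin_of_mem_nhds hball] with u hu hmem
      have := hodd (p.1, u) hmem hu
      rw [this, add_neg_cancel]
    have := eq_zero_of_eventually_ne hcont hev
    rw [neg_zero, ← two_mul] at this
    rw [hz]
    exact (mul_eq_zero.1 this).resolve_left two_ne_zero
  -- second division: `q₁ = u q`
  obtain ⟨q, hqd, hq⟩ := exists_eq_smul_of_eqOn_zero hU htd hq₁d hdt hq₁0
  simp only [smul_eq_mul] at hq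
  refine ⟨q, hqd, fun p hp => by rw [hq₁ p hp, hq p hp]; ring, fun p hp => ?_⟩
  by_cases hp0 : p.2 = 0
  · have : (p.1, -p.2) = p := Prod.ext rfl (by rw [hp0, neg_zero])
    rw [this]
  · have h1 := hq₁ p hp
    have h2 := hq₁ _ (hrefl p hp)
    rw [heven p hp, h1, hq p hp, hq _ (hrefl p hp)] at h2
    have : ((p.1, -p.2) : E × ℂ).2 = -p.2 := rfl
    rw [this] at h2
    -- h2 : p.2 * (p.2 * q p) = -p.2 * (-p.2 * q (p.1, -p.2))
    have h3 : p.2 ^ 2 * (q (p.1, -p.2) - q p) = 0 := by linear_combination -h2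
    exact sub_eq_zero.1 ((mul_eq_zero.1 h3).resolve_left (pow_ne_zero 2 hp0))

/-- **The `u`-derivative of `u² q`.**  If `f = u² · q` on `V × {|u| < R}` (`q` holomorphic) and `∂_u f = u · s` there
with `s` continuous, then `s = 2 q + u · ∂_u q` on the whole domain (`u ≠ 0`: product rule and cancel `u`; `u = 0`:
continuity). [cite: Chirka1989, §2.8] -/
theorem eq_two_mul_add_of_sq_mul [FiniteDimensional ℂ E] {V : Set E} (hV : IsOpen V) {R : ℝ}
    {f q s : E × ℂ → ℂ} (hq : DifferentiableOn ℂ q (V ×ˢ ball (0 : ℂ) R))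
    (hs : ContinuousOn s (V ×ˢ ball (0 : ℂ) R))
    (hf : ∀ p ∈ V ×ˢ ball (0 : ℂ) R, f p = p.2 ^ 2 * q p)
    (hfu : ∀ p ∈ V ×ˢ ball (0 : ℂ) R, fderiv ℂ f p (0, 1) = p.2 * s p) :
    ∀ p ∈ V ×ˢ ball (0 : ℂ) R, s p = 2 * q p + p.2 * fderiv ℂ q p (0, 1) := by
  have hU : IsOpen (V ×ˢ ball (0 : ℂ) R) := hV.prod isOpen_ball
  -- the identity off the axis
  have hoff : ∀ p ∈ V ×ˢ ball (0 : ℂ) R, p.2 ≠ 0 → s p = 2 * q p + p.2 * fderiv ℂ q p (0, 1) := by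
    intro p hp hne
    have heq : f =ᶠ[𝓝 p] fun p : E × ℂ => p.2 ^ 2 * q p := by
      filter_upwards [hU.mem_nhds hp] with p' hp'
      exact hf p' hp'
    have hqd : HasFDerivAt q (fderiv ℂ q p) p := (hq.differentiableAt (hU.mem_nhds hp)).hasFDerivAt
    have hsq : HasFDerivAt (fun p : E × ℂ => p.2 ^ 2) ((2 * p.2) • ContinuousLinearMap.snd ℂ E ℂ) p := by
      have h := (ContinuousLinearMap.snd ℂ E ℂ).hasFDerivAt (x := p)
      have h2 := h.pow 2
      simpa [pow_one] using h2
    have hprod := hsq.fun_mul hqd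
    have hder : fderiv ℂ f p = fderiv ℂ (fun p : E × ℂ => p.2 ^ 2 * q p) p := heq.fderiv_eq
    have h1 := hfu p hp
    rw [hder, hprod.fderiv] at h1
    simp only [add_apply, smul_apply, ContinuousLinearMap.coe_snd', smul_eq_mul] at h1
    -- h1 : p.2 ^ 2 * fderiv q p (0,1) + (2 * p.2) * 1 * q p = p.2 * s p  (up to the exact shape)
    have h2 : p.2 * (s p - (2 * q p + p.2 * fderiv ℂ q p (0, 1))) = 0 := by linear_combination -h1
    exact sub_eq_zero.1 ((mul_eq_zero.1 h2).resolve_left hne)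
  -- continuity of `∂_u q`
  have hqA : AnalyticOnNhd ℂ q (V ×ˢ ball (0 : ℂ) R) := analyticOnNhd_of_differentiableOn hq hU
  have hqC : ContinuousOn (fun p => fderiv ℂ q p (0, 1)) (V ×ˢ ball (0 : ℂ) R) :=
    ((hqA.contDiffOn hU.uniqueDiffOn (n := 1)).continuousOn_fderiv_of_isOpen hU le_rfl).clm_apply
      continuousOn_const
  intro p hp
  by_cases hne : p.2 ≠ 0
  · exact hoff p hp hne
  push Not at hne
  have hz : p = (p.1, 0) := Prod.ext rfl hne
  -- on the axis: the difference is continuous in `u` and vanishes for `u ≠ 0`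
  have hball : ∀ᶠ u in 𝓝 (0 : ℂ), ((p.1, u) : E × ℂ) ∈ V ×ˢ ball (0 : ℂ) R := by
    have e1 : Continuous (fun u : ℂ => ((p.1, u) : E × ℂ)) := by fun_prop
    exact e1.continuousAt.preimage_mem_nhds (hU.mem_nhds (by exact hz ▸ hp))
  have hcont : ContinuousAt (fun u : ℂ => s (p.1, u) - (2 * q (p.1, u) + u * fderiv ℂ q (p.1, u) (0, 1))) 0 := by
    have hp' : ((p.1, (0 : ℂ)) : E × ℂ) ∈ V ×ˢ ball (0 : ℂ) R := hz ▸ hp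
    have e1 : ContinuousAt (fun u : ℂ => ((p.1, u) : E × ℂ)) 0 := by fun_prop
    have c1 : ContinuousAt s (p.1, 0) := hs.continuousAt (hU.mem_nhds hp')
    have c2 : ContinuousAt q (p.1, 0) := hq.continuousOn.continuousAt (hU.mem_nhds hp')
    have c3 : ContinuousAt (fun p => fderiv ℂ q p (0, 1)) (p.1, 0) := hqC.continuousAt (hU.mem_nhds hp')
    exact (c1.comp e1).sub (((c2.comp e1).const_mul 2).add (continuousAt_id.mul (c3.comp e1)))
  have hev : ∀ᶠ u in 𝓝[≠] (0 : ℂ), s (p.1, u) - (2 * q (p.1, u) + u * fderiv ℂ q (p.1, u) (0, 1)) = 0 := by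
    have h' : ∀ᶠ u in 𝓝[≠] (0 : ℂ), u ≠ 0 := self_mem_nhdsWithin
    filter_upwards [h', mem_nhdsWithin_of_mem_nhds hball] with u hu hmem
    rw [hoff (p.1, u) hmem hu, sub_self]
  have := eq_zero_of_eventually_ne hcont hev
  rw [hz]
  simpa [sub_eq_zero] using this

/-- **Derivative of a product at a zero of the first factor**: if `f = t · g` near `p₀` with `t(p₀) = 0`, then
`df(p₀) = g(p₀) · dt(p₀)`. [cite: Chirka1989, §2.8] -/
theorem fderiv_eq_smul_of_eq_mul {P : Type*} [NormedAddCommGroup P] [NormedSpace ℂ P] {U : Set P} (hU : IsOpen U)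
    {p₀ : P} (hp₀ : p₀ ∈ U) {f t g : P → ℂ} (ht : DifferentiableOn ℂ t U) (hg : DifferentiableOn ℂ g U)
    (hf : ∀ p ∈ U, f p = t p * g p) (h0 : t p₀ = 0) :
    fderiv ℂ f p₀ = g p₀ • fderiv ℂ t p₀ := by
  have heq : f =ᶠ[𝓝 p₀] fun p => t p * g p := by
    filter_upwards [hU.mem_nhds hp₀] with p hp
    exact hf p hp
  have htd : HasFDerivAt t (fderiv ℂ t p₀) p₀ := (ht.differentiableAt (hU.mem_nhds hp₀)).hasFDerivAt
  have hgd : HasFDerivAt g (fderiv ℂ g p₀) p₀ := (hg.differentiableAt (hU.mem_nhds hp₀)).hasFDerivAt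
  rw [heq.fderiv_eq, (htd.fun_mul hgd).fderiv, h0]
  ext v
  simp [add_apply, smul_apply]

end SCV
end Literature.Analysis.Complex

end
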